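import Summits.HodgeConjecture.HodgeConjecture.Theorems.ThreefoldSquareKunnethConverse
import Summits.HodgeConjecture.HodgeConjecture.Theorems.ThreefoldSquareMiddleDegree
import Summits.HodgeConjecture.HodgeConjecture.Theorems.ThreefoldSquareWeightOneRetractions
import Literature.AlgebraicGeometry.HodgeTheory.BettiHodgeConjectureProductsReducedKunnethPieces
import HarnessLib

/-!
# The Hodge conjecture for the WHOLE square `X × X` of an arbitrary smooth projective threefold, in every codimension,
# from `B⋆(X)`, the weight-two corner `E₂(X)`, the odd slots `W₁₃(X)` and `End_Hdg(H³(X))` — and `End_Hdg(H³(X))`-free on the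
# coniveau-one locus `N¹H³ = H³` (cell `hodge-nonav`, sector SQ3, rows SQ12 / RED / S19)

PROVENANCE. Cell hodge-nonav (HUMAN RULING D-0038), prover seat `hodge-nonav-19716-p2` (g3), proposal (vii) to the planner p1 g35
(STATUS 2026-08-28T07:1xZ) after targets (iv) (`Theorems/ThreefoldSquareMiddleDegree`) and (v)
(`Theorems/ThreefoldSquareKunnethConverse`). SUPPORT FILE (`--supports stmt-HodgeConjecture-19654 --as helper`).

THE POINT. The tree's four-piece criterion for two threefolds
(`BettiUniverse.hodgeConjectureFor_tensor_threefolds_of_kunneth_pieces`: `HC(T × T')` as soon as the Hodge classes of the Künneth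
pieces `(1,3)`, `(2,2)`, `(3,1)` of `H⁴` and `(3,3)` of `H⁶` are algebraic — the other pieces by hard Lefschetz, Lefschetz `(1,1)` and
`HC` in dimension `3`, all unconditional) is fed with the junk-killing lemma of `Theorems/ThreefoldSquareKunnethConverse`
(`ofRatClass_crossMap_mem_algebraicClasses_of_isAlgebraicCorrespondence`: under `B⋆(X)` a Künneth summand whose ACTION is an
algebraic correspondence is an algebraic CLASS): the four actions are rational Hodge shifts `H³ → H¹`, `H⁴ → H²`, `H⁵ → H³` (bidegree
`(−1,−1)`) and `H³ → H³` (bidegree `(0,0)`), algebraic by `W₁₃(X)`, `E₂(X)`, `W₁₃(X)`, `E₃(X)` respectively. On the locus `N¹H³(X) = H³(X)`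
the piece `(3,3)` is algebraic outright (`Theorems/ThreefoldSquareMiddleDegree` §3), so `E₃(X)` drops out.

CONTENT (sorry-free over tree theorems; no definition, no named fact, no new axiom): §1 the four Künneth summands as algebraic classes
(`kunnethSummand_one_three_algebraic_of_oddShifts`, `…_two_two_algebraic_of_E2`, `…_three_one_algebraic_of_oddShifts`,
`…_three_three_algebraic_of_E3`, `…_three_three_algebraic_of_supportedClasses_three_one_eq_top`); §2
**`hodgeConjectureFor_sq_of_B_of_E2_of_oddShifts_of_E3`** (`HodgeConjectureFor 6 (X ⊗ X)` ⟸ `B⋆(X) ∧ E₂(X) ∧ W₁₃(X) ∧ E₃(X)`, EVERY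
smooth projective threefold) and **`hodgeConjectureFor_sq_of_B_of_E2_of_oddShifts_of_supportedClasses_three_one_eq_top`** (`E₃` replaced
by `N¹H³ = H³`); §3 the geometric forms: **`hodgeConjectureFor_sq_of_B_surface_curves_E3`** (`⟸ B⋆(X) ∧ E(S) ∧ W1Retr[X] ∧ HC22C[X] ∧ E₃(X)`
for one surface `i : S ⟶ X` with `i_* 1_S` polarising), **`hodgeConjectureFor_sq_of_B_surface_bertini_E3`** (`W1Retr` discharged by the
Hartshorne–Bertini named fact, `w1Retr_of_bertini`), and the `E₃`-free **`hodgeConjectureFor_sq_of_B_surface_bertini_of_supportedClasses_three_one_eq_top`**,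
**`hodgeConjectureFor_sq_of_B_surface_bertini_of_hasChowZeroSupportedInDimLE_two`** (`CH₀(X)` on a surface, e.g. uniruled) and the
Tankeev form off general type.

HONEST SCOPE. Reductions: for an ARBITRARY threefold the open inputs `B⋆(X)`, `E(S)` (i.e. `End_Hdg(T²(S))` algebraic), `HC22C[X]`
(the `(2,2)`-classes of `X × C`, `C × X` for curves `C`) and `E₃(X)` remain displayed hypotheses; the named facts (Bertini, Tankeev,
Debarre) are displayed binders. Nothing here proves the Hodge conjecture for a new variety; rung F-H1 not moved.

## References

* [VoisinHodgeI2002] C. Voisin, Hodge Theory and Complex Algebraic Geometry I (2002), §6.2.3 Thm. 6.25, §11.3.3 Thm. 11.38–11.41.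
* [Kleiman1968AlgebraicCycles] S. Kleiman, Algebraic cycles and the Weil conjectures (1968), §2 Prop. 2.3, Thm. 2A11.
* [Andre1996Motifs] Y. André, Pour une théorie inconditionnelle des motifs (1996), §0.2, §1.1, §2.1.
* [BlochSrinivas1983] S. Bloch, V. Srinivas, Remarks on correspondences and algebraic cycles (1983), Thm. 1.
* [Hartshorne1977] R. Hartshorne, Algebraic Geometry (1977), II Thm. 8.18, III Cor. 7.9.
* [Tankeev2011] S. Tankeev, Izv. Math. 75 (2011), main theorem.
-/

set_option linter.dupNamespace false

noncomputable section

open CategoryTheory AlgebraicGeometry MonoidalCategory CartesianMonoidalCategory Finset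
open scoped TensorProduct
open Literature.AlgebraicTopology.SingularHomology
open Literature.AlgebraicGeometry Literature.AlgebraicGeometry.Motives Literature.AlgebraicGeometry.HodgeTheory
open Literature.Barriers.HodgeConjecture
open Literature.AlgebraicGeometry.Tankeev2011
open Summit.HodgeConjecture.HodgeConjecture.Theorems
open Summit.HodgeConjecture.HodgeConjecture.Ring2.AbelianAll

namespace Summit.HodgeConjecture.HodgeConjecture.Theorems.ThreefoldSquare

/-- `RHShift[m, n, Y, X, a, b, e, φ]` (as in `Theorems/ThreefoldSquareKunnethShifts`). Local notation only. -/
local notation3 (prettyPrint := false) "RHShift[" m ", " n ", " Y ", " X ", " a ", " b ", " e ", " φ "]" =>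
  ((∀ c, IsRationalClass c → IsRationalClass (φ c)) ∧
  (∀ (p q : ℕ), p + q = a → ∀ c, IsOfHodgeType n X a p q c →
      ∀ (p' q' : ℕ), p' + n = p + e → q' + n = q + e → IsOfHodgeType m Y b p' q' (φ c)) ∧
  (∀ (p q : ℕ), p + q = a → ∀ c, IsOfHodgeType n X a p q c → (p + e < n ∨ q + e < n) → φ c = 0))

/-- `E2[X]` (as in `Theorems/ThreefoldSquareWeightTwoDescent`). Local notation only. -/
local notation3 (prettyPrint := false) "E2[" X "]" =>
  (∀ φ : complexBetti X (2 * 2) →ₗ[ℂ] complexBetti X (2 * 1),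
    RHShift[3, 3, X, X, 2 * 2, 2 * 1, 2, φ] → IsAlgebraicCorrespondence 3 3 X X φ)

/-- `E3[X]`: every rational Hodge ENDOMORPHISM of `H³(X)` (bidegree `(0,0)`) is an algebraic self-correspondence of `X` — the middle
Künneth piece `H³(X) ⊗ H³(X) ⊂ H⁶(X × X)` in operator form (`End_Hdg(H³(X))` algebraic; contains the endomorphisms of the intermediate
Jacobian's Hodge structure). Local notation only. -/
local notation3 (prettyPrint := false) "E3[" X "]" =>
  (∀ φ : complexBetti X 3 →ₗ[ℂ] complexBetti X 3,
    RHShift[3, 3, X, X, 3, 3, 3, φ] → IsAlgebraicCorrespondence 3 3 X X φ)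

/-- `ES[S]` (as in `Theorems/ThreefoldSquareWeightTwoDescent`). Local notation only. -/
local notation3 (prettyPrint := false) "ES[" S "]" =>
  (∀ ψ : complexBetti S (2 * 1) →ₗ[ℂ] complexBetti S (2 * 1),
    RHShift[2, 2, S, S, 2 * 1, 2 * 1, 2, ψ] → IsAlgebraicCorrespondence 2 2 S S ψ)

/-- `OddShifts[X]` (as in `Theorems/ThreefoldSquareKunnethShifts`). Local notation only. -/
local notation3 (prettyPrint := false) "OddShifts[" X "]" =>
  ((∀ φ : complexBetti X 5 →ₗ[ℂ] complexBetti X 3,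
    RHShift[3, 3, X, X, 5, 3, 2, φ] → IsAlgebraicCorrespondence 3 3 X X φ) ∧
  (∀ φ : complexBetti X 3 →ₗ[ℂ] complexBetti X 1,
    RHShift[3, 3, X, X, 3, 1, 2, φ] → IsAlgebraicCorrespondence 3 3 X X φ))

/-- `W1Retr[X]` (as in `Theorems/ThreefoldSquareKunnethShifts`). Local notation only. -/
local notation3 (prettyPrint := false) "W1Retr[" X "]" =>
  (∃ (C : SchemeOver ℂ) (_ : IsSmoothProjective 1 C)
    (u : complexBetti X 5 →ₗ[ℂ] complexBetti C 1) (v : complexBetti C 1 →ₗ[ℂ] complexBetti X 5)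
    (u' : complexBetti X 1 →ₗ[ℂ] complexBetti C 1) (v' : complexBetti C 1 →ₗ[ℂ] complexBetti X 1),
    IsAlgebraicCorrespondence 1 3 C X u ∧ RHShift[3, 1, X, C, 1, 5, 3, v] ∧ v ∘ₗ u = LinearMap.id ∧
    IsAlgebraicCorrespondence 3 1 X C v' ∧ RHShift[1, 3, C, X, 1, 1, 3, u'] ∧ v' ∘ₗ u' = LinearMap.id)

/-- `HC22C[X]` (as in `Theorems/ThreefoldSquareKunnethShifts`; body of `ThreefoldTimesCurve.HC22TimesCurve X`). Local notation only. -/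
local notation3 (prettyPrint := false) "HC22C[" X "]" =>
  (∀ ⦃C : SchemeOver ℂ⦄, IsSmoothProjective 1 C →
    (∀ c : complexBetti (X ⊗ C) (2 * 2), IsRationalClass c →
        IsOfHodgeType (3 + 1) (X ⊗ C) (2 * 2) 2 2 c → c ∈ algebraicClasses (X ⊗ C) 2) ∧
      (∀ c : complexBetti (C ⊗ X) (2 * 2), IsRationalClass c →
        IsOfHodgeType (1 + 3) (C ⊗ X) (2 * 2) 2 2 c → c ∈ algebraicClasses (C ⊗ X) 2))

/-- `SecCl[hS, hX, i]` (as in `Theorems/ThreefoldSquareWeightTwoDescent`). Local notation only. -/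
local notation3 (prettyPrint := false) "SecCl[" hS ", " hX ", " i "]" =>
  complexGysin complexOrientationFamily hS hX i (rfl : 0 + 2 * 3 = 2 + 2 * 2)
    (singularCohomology.one ℂ (ComplexPoints _))

variable {X S : SchemeOver ℂ}

/-! ## §1 The four Künneth summands as algebraic classes -/

section Pieces

variable [HodgeTensorFacts.{0, 0}]

/-- **The summand `H¹(X;ℚ) ⊗ H³(X;ℚ)` of `H⁴` is algebraic under `B⋆(X, η)` and `W₁₃(X)`** (its Hodge classes act `H³ → H¹` as rational Hodge
shifts of bidegree `(−1,−1)`). [cite: VoisinHodgeI2002, §11.3.3 Lemma 11.41 and p. 286] [cite: Kleiman1968AlgebraicCycles, §2 Prop. 2.3] -/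
theorem kunnethSummand_one_three_algebraic_of_oddShifts (hHD : exists_isReal_hodgeModel) (hX : IsSmoothProjective 3 X)
    {η : complexBetti X 2} (hη : IsPolarizationClass 3 X η) (hB : StandardConjectureBStar 3 X η) (hOdd : OddShifts[X]) :
    ∀ t ∈ (BettiUniverse.kunnethSummand hHD hX hX (2 * 2) ⟨(1, 3), HasAntidiagonal.mem_antidiagonal.2 rfl⟩).hodgeClasses 2,
      ofRatClass (ComplexPoints (X ⊗ X)) (2 * 2) (BettiUniverse.crossMap X X (show 1 + 3 = 2 * 2 by norm_num) t) ∈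
        algebraicClasses (X ⊗ X) 2 := fun t ht ↦ by
  have T := BettiUniverse.typeShift_corrAction_crossMap_of_mem_hodgeClasses hHD hX hX (show 1 + 3 = 2 * 2 by norm_num)
    (show 3 + 2 * 2 = 1 + 2 * 3 by norm_num) ht
  exact ofRatClass_crossMap_mem_algebraicClasses_of_isAlgebraicCorrespondence hX hη hB _ (a := 3) (by norm_num)
    (by norm_num) (hOdd.2 _ ⟨fun u hu ↦ T.1 u hu, fun p q _ u hu p' q' hp hq ↦ T.2.1 p q u hu p' q' hp hq,
      fun p q _ u hu h ↦ T.2.2 p q u hu h⟩)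

/-- **The summand `H²(X;ℚ) ⊗ H²(X;ℚ)` of `H⁴` is algebraic under `B⋆(X, η)` and `E₂(X)`** (action `H⁴ → H²` of bidegree `(−1,−1)`).
[cite: VoisinHodgeI2002, §11.3.3 Lemma 11.41 and p. 286] [cite: Kleiman1968AlgebraicCycles, §2 Prop. 2.3] -/
theorem kunnethSummand_two_two_algebraic_of_E2 (hHD : exists_isReal_hodgeModel) (hX : IsSmoothProjective 3 X)
    {η : complexBetti X 2} (hη : IsPolarizationClass 3 X η) (hB : StandardConjectureBStar 3 X η) (hE2 : E2[X]) :
    ∀ t ∈ (BettiUniverse.kunnethSummand hHD hX hX (2 * 2) ⟨(2, 2), HasAntidiagonal.mem_antidiagonal.2 rfl⟩).hodgeClasses 2,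
      ofRatClass (ComplexPoints (X ⊗ X)) (2 * 2) (BettiUniverse.crossMap X X (show 2 + 2 = 2 * 2 by norm_num) t) ∈
        algebraicClasses (X ⊗ X) 2 := fun t ht ↦ by
  have T := BettiUniverse.typeShift_corrAction_crossMap_of_mem_hodgeClasses hHD hX hX (show 2 + 2 = 2 * 2 by norm_num)
    (show 2 * 2 + 2 * 2 = 2 + 2 * 3 by norm_num) ht
  have hA : IsAlgebraicCorrespondence 3 3 X X (corrAction complexOrientationFamily hX hX
      (show 2 * 2 + 2 * 2 = 2 * 1 + 2 * 3 by norm_num)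
      (ofRatClass (ComplexPoints (X ⊗ X)) (2 * 2) (BettiUniverse.crossMap X X (show 2 + 2 = 2 * 2 by norm_num) t))) :=
    hE2 _ ⟨fun u hu ↦ T.1 u hu, fun p q _ u hu p' q' hp hq ↦ T.2.1 p q u hu p' q' hp hq,
      fun p q _ u hu h ↦ T.2.2 p q u hu h⟩
  exact ofRatClass_crossMap_mem_algebraicClasses_of_isAlgebraicCorrespondence hX hη hB _ (a := 2 * 2)
    (by norm_num) (by norm_num) hA

/-- **The summand `H³(X;ℚ) ⊗ H¹(X;ℚ)` of `H⁴` is algebraic under `B⋆(X, η)` and `W₁₃(X)`** (action `H⁵ → H³` of bidegree `(−1,−1)`).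
[cite: VoisinHodgeI2002, §11.3.3 Lemma 11.41 and p. 286] [cite: Kleiman1968AlgebraicCycles, §2 Prop. 2.3] -/
theorem kunnethSummand_three_one_algebraic_of_oddShifts (hHD : exists_isReal_hodgeModel) (hX : IsSmoothProjective 3 X)
    {η : complexBetti X 2} (hη : IsPolarizationClass 3 X η) (hB : StandardConjectureBStar 3 X η) (hOdd : OddShifts[X]) :
    ∀ t ∈ (BettiUniverse.kunnethSummand hHD hX hX (2 * 2) ⟨(3, 1), HasAntidiagonal.mem_antidiagonal.2 rfl⟩).hodgeClasses 2,
      ofRatClass (ComplexPoints (X ⊗ X)) (2 * 2) (BettiUniverse.crossMap X X (show 3 + 1 = 2 * 2 by norm_num) t) ∈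
        algebraicClasses (X ⊗ X) 2 := fun t ht ↦ by
  have T := BettiUniverse.typeShift_corrAction_crossMap_of_mem_hodgeClasses hHD hX hX (show 3 + 1 = 2 * 2 by norm_num)
    (show 5 + 2 * 2 = 3 + 2 * 3 by norm_num) ht
  exact ofRatClass_crossMap_mem_algebraicClasses_of_isAlgebraicCorrespondence hX hη hB _ (a := 5) (by norm_num)
    (by norm_num) (hOdd.1 _ ⟨fun u hu ↦ T.1 u hu, fun p q _ u hu p' q' hp hq ↦ T.2.1 p q u hu p' q' hp hq,
      fun p q _ u hu h ↦ T.2.2 p q u hu h⟩)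

/-- **The middle summand `H³(X;ℚ) ⊗ H³(X;ℚ)` of `H⁶` is algebraic under `B⋆(X, η)` and `E₃(X)`** (its Hodge classes act `H³ → H³` as
rational Hodge endomorphisms). [cite: VoisinHodgeI2002, §11.3.3 Lemma 11.41 and p. 286] [cite: Kleiman1968AlgebraicCycles, §2 Prop. 2.3] -/
theorem kunnethSummand_three_three_algebraic_of_E3 (hHD : exists_isReal_hodgeModel) (hX : IsSmoothProjective 3 X)
    {η : complexBetti X 2} (hη : IsPolarizationClass 3 X η) (hB : StandardConjectureBStar 3 X η) (hE3 : E3[X]) :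
    ∀ t ∈ (BettiUniverse.kunnethSummand hHD hX hX (2 * 3) ⟨(3, 3), HasAntidiagonal.mem_antidiagonal.2 rfl⟩).hodgeClasses 3,
      ofRatClass (ComplexPoints (X ⊗ X)) (2 * 3) (BettiUniverse.crossMap X X (show 3 + 3 = 2 * 3 by norm_num) t) ∈
        algebraicClasses (X ⊗ X) 3 := fun t ht ↦ by
  have T := BettiUniverse.typeShift_corrAction_crossMap_of_mem_hodgeClasses hHD hX hX (show 3 + 3 = 2 * 3 by norm_num)
    (show 3 + 2 * 3 = 3 + 2 * 3 by norm_num) ht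
  exact ofRatClass_crossMap_mem_algebraicClasses_of_isAlgebraicCorrespondence hX hη hB _ (a := 3) (by norm_num)
    (by norm_num) (hE3 _ ⟨fun u hu ↦ T.1 u hu, fun p q _ u hu p' q' hp hq ↦ T.2.1 p q u hu p' q' hp hq,
      fun p q _ u hu h ↦ T.2.2 p q u hu h⟩)

/-- **On the coniveau-one locus `N¹H³(X) = H³(X)` the middle summand is algebraic WITHOUT `B⋆` or `E₃`**
(`hodgeThreeThree_slot_algebraic_of_supportedClasses_three_one_eq_top` of `Theorems/ThreefoldSquareMiddleDegree` applied to `t ⊗ 1`).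
[cite: Voisin2025, Cor. 2.12] [cite: DeligneHodgeIII1974, Cor. 8.2.8] [cite: BlochSrinivas1983, Thm. 1] -/
theorem kunnethSummand_three_three_algebraic_of_supportedClasses_three_one_eq_top (hHD : exists_isReal_hodgeModel)
    (hX : IsSmoothProjective 3 X) (hN : supportedClasses X 3 1 = ⊤) :
    ∀ t ∈ (BettiUniverse.kunnethSummand hHD hX hX (2 * 3) ⟨(3, 3), HasAntidiagonal.mem_antidiagonal.2 rfl⟩).hodgeClasses 3,
      ofRatClass (ComplexPoints (X ⊗ X)) (2 * 3) (BettiUniverse.crossMap X X (show 3 + 3 = 2 * 3 by norm_num) t) ∈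
        algebraicClasses (X ⊗ X) 3 := fun t ht ↦
  hodgeThreeThree_slot_algebraic_of_supportedClasses_three_one_eq_top hX hN _
    (ofRatClass_crossMap_mem_kunnethPiece _ t) (isRationalClass_ofRatClass _)
    ((BettiUniverse.mem_hodgeClasses_kunnethSummand_iff_isOfHodgeType hHD hX hX (show 3 + 3 = 2 * 3 by norm_num) t).1 ht)

end Pieces

/-! ## §2 The whole square -/

/-- **`HC(X × X)` in EVERY codimension, for EVERY smooth projective threefold, from `B⋆(X)` (all classes), `E₂(X)`, `W₁₃(X)` and
`E₃(X)`** — the tree's four-piece criterion `BettiUniverse.hodgeConjectureFor_tensor_threefolds_of_kunneth_pieces` with the pieces of §1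
at one polarisation class (`nonempty_kaehlerRationalDatum`). (statement: cell hodge-nonav rows SQ12 / S19 in operator form; reduction,
not in print) [cite: VoisinHodgeI2002, §11.3.3 Thm. 11.38–11.41 and §6.2.3 Thm. 6.25] [cite: Kleiman1968AlgebraicCycles, §2 Prop. 2.3 and Thm. 2A11] -/
theorem hodgeConjectureFor_sq_of_B_of_E2_of_oddShifts_of_E3 (hX : IsSmoothProjective 3 X)
    (hB : ∀ η : complexBetti X 2, StandardConjectureBStar 3 X η) (hE2 : E2[X]) (hOdd : OddShifts[X]) (hE3 : E3[X]) :
    HodgeConjectureFor 6 (X ⊗ X) := by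
  haveI : HodgeTensorFacts.{0, 0} := hodgeTensorFacts_holds
  have hHD : exists_isReal_hodgeModel := exists_isReal_hodgeModel_holds
  have hXX : IsSmoothProjective 6 (X ⊗ X) := hX.tensor_holds hX
  obtain ⟨D⟩ := nonempty_kaehlerRationalDatum hX
  have hη : IsPolarizationClass 3 X D.Hη := D.isPolarizationClass_Hη hX
  exact BettiUniverse.hodgeConjectureFor_tensor_threefolds_of_kunneth_pieces hHD hX hX hXX
    (kunnethSummand_one_three_algebraic_of_oddShifts hHD hX hη (hB _) hOdd)
    (kunnethSummand_two_two_algebraic_of_E2 hHD hX hη (hB _) hE2)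
    (kunnethSummand_three_one_algebraic_of_oddShifts hHD hX hη (hB _) hOdd)
    (kunnethSummand_three_three_algebraic_of_E3 hHD hX hη (hB _) hE3)

/-- **`HC(X × X)` in EVERY codimension from `B⋆(X)`, `E₂(X)`, `W₁₃(X)` when `N¹H³(X) = H³(X)`** (no `E₃(X)`: the middle piece by
`Theorems/ThreefoldSquareMiddleDegree`). [cite: VoisinHodgeI2002, §11.3.3 Thm. 11.38–11.41] [cite: Voisin2025, Cor. 2.12] [cite: BlochSrinivas1983, Thm. 1] -/
theorem hodgeConjectureFor_sq_of_B_of_E2_of_oddShifts_of_supportedClasses_three_one_eq_top (hX : IsSmoothProjective 3 X)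
    (hB : ∀ η : complexBetti X 2, StandardConjectureBStar 3 X η) (hE2 : E2[X]) (hOdd : OddShifts[X])
    (hN : supportedClasses X 3 1 = ⊤) : HodgeConjectureFor 6 (X ⊗ X) := by
  haveI : HodgeTensorFacts.{0, 0} := hodgeTensorFacts_holds
  have hHD : exists_isReal_hodgeModel := exists_isReal_hodgeModel_holds
  have hXX : IsSmoothProjective 6 (X ⊗ X) := hX.tensor_holds hX
  obtain ⟨D⟩ := nonempty_kaehlerRationalDatum hX
  have hη : IsPolarizationClass 3 X D.Hη := D.isPolarizationClass_Hη hX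
  exact BettiUniverse.hodgeConjectureFor_tensor_threefolds_of_kunneth_pieces hHD hX hX hXX
    (kunnethSummand_one_three_algebraic_of_oddShifts hHD hX hη (hB _) hOdd)
    (kunnethSummand_two_two_algebraic_of_E2 hHD hX hη (hB _) hE2)
    (kunnethSummand_three_one_algebraic_of_oddShifts hHD hX hη (hB _) hOdd)
    (kunnethSummand_three_three_algebraic_of_supportedClasses_three_one_eq_top hHD hX hN)

/-! ## §3 Geometric forms -/

/-- **`HC(X × X) ⟸ B⋆(X) ∧ E(S) ∧ W1Retr[X] ∧ HC22C[X] ∧ E₃(X)`** for one surface `i : S ⟶ X` whose class `i_* 1_S` is polarising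
(`E₂ ⟸ B⋆[σ] ∧ E(S)` by `weightTwoShift_algebraic_of_B_of_surface`; `W₁₃ ⟸ W1Retr ∧ HC22C` by `oddShifts_algebraic_of_hc22TimesCurve`).
[cite: Andre1996Motifs, §1.1 (p. 10) and §2.1] [cite: VoisinHodgeI2002, §11.3.3 Lemma 11.41] -/
theorem hodgeConjectureFor_sq_of_B_surface_curves_E3 (hX : IsSmoothProjective 3 X)
    (hS : IsSmoothProjective 2 S) (i : S ⟶ X) (hσ : IsPolarizationClass 3 X (SecCl[hS, hX, i]))
    (hB : ∀ η : complexBetti X 2, StandardConjectureBStar 3 X η) (hE : ES[S])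
    (hR : W1Retr[X]) (h : HC22C[X]) (hE3 : E3[X]) : HodgeConjectureFor 6 (X ⊗ X) :=
  hodgeConjectureFor_sq_of_B_of_E2_of_oddShifts_of_E3 hX hB (weightTwoShift_algebraic_of_B_of_surface hX hS i hσ (hB _) hE)
    (oddShifts_algebraic_of_hc22TimesCurve hX hR h) hE3

/-- **Bertini form: `HC(X × X) ⟸ B⋆(X) ∧ E(S) ∧ HC22C[X] ∧ E₃(X)`**, the weight-one retractions coming from a curve of class `c • σ²`
(`w1Retr_of_bertini`); CONDITIONAL on the displayed Hartshorne–Bertini named fact. [cite: Hartshorne1977, II Thm. 8.18 and III Cor. 7.9]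
[cite: VoisinHodgeI2002, §11.3.3 Lemma 11.41] -/
theorem hodgeConjectureFor_sq_of_B_surface_bertini_E3 (hBert : Hartshorne1977_bertini_smoothHyperplaneSections)
    (hX : IsSmoothProjective 3 X) (hS : IsSmoothProjective 2 S) (i : S ⟶ X) (hσ : IsPolarizationClass 3 X (SecCl[hS, hX, i]))
    (hB : ∀ η : complexBetti X 2, StandardConjectureBStar 3 X η) (hE : ES[S]) (h : HC22C[X]) (hE3 : E3[X]) :
    HodgeConjectureFor 6 (X ⊗ X) :=
  hodgeConjectureFor_sq_of_B_surface_curves_E3 hX hS i hσ hB hE (w1Retr_of_bertini hBert hX) h hE3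

/-- **`E₃`-free on the coniveau-one locus: `HC(X × X) ⟸ B⋆(X) ∧ E(S) ∧ HC22C[X]` when `N¹H³(X) = H³(X)`** (Bertini form; e.g. `X` uniruled).
[cite: BlochSrinivas1983, Thm. 1] [cite: Voisin2025, Cor. 2.12] [cite: Hartshorne1977, II Thm. 8.18 and III Cor. 7.9] -/
theorem hodgeConjectureFor_sq_of_B_surface_bertini_of_supportedClasses_three_one_eq_top
    (hBert : Hartshorne1977_bertini_smoothHyperplaneSections) (hX : IsSmoothProjective 3 X) (hS : IsSmoothProjective 2 S) (i : S ⟶ X)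
    (hσ : IsPolarizationClass 3 X (SecCl[hS, hX, i])) (hB : ∀ η : complexBetti X 2, StandardConjectureBStar 3 X η) (hE : ES[S])
    (h : HC22C[X]) (hN : supportedClasses X 3 1 = ⊤) : HodgeConjectureFor 6 (X ⊗ X) :=
  hodgeConjectureFor_sq_of_B_of_E2_of_oddShifts_of_supportedClasses_three_one_eq_top hX hB
    (weightTwoShift_algebraic_of_B_of_surface hX hS i hσ (hB _) hE)
    (oddShifts_algebraic_of_bertini_of_hc22TimesCurve hBert hX h) hN

/-- **`CH₀(X)` supported on a surface** (`N¹H³ = H³` by Bloch–Srinivas): `HC(X × X) ⟸ B⋆(X) ∧ E(S) ∧ HC22C[X]` (Bertini form).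
[cite: BlochSrinivas1983, Thm. 1 (2)] [cite: VoisinHodgeII2003, Thm. 10.17 and §10.2.3] -/
theorem hodgeConjectureFor_sq_of_B_surface_bertini_of_hasChowZeroSupportedInDimLE_two
    (hBert : Hartshorne1977_bertini_smoothHyperplaneSections) (hX : IsSmoothProjective 3 X) (hW : HasChowZeroSupportedInDimLE X 2)
    (hS : IsSmoothProjective 2 S) (i : S ⟶ X) (hσ : IsPolarizationClass 3 X (SecCl[hS, hX, i]))
    (hB : ∀ η : complexBetti X 2, StandardConjectureBStar 3 X η) (hE : ES[S]) (h : HC22C[X]) : HodgeConjectureFor 6 (X ⊗ X) :=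
  hodgeConjectureFor_sq_of_B_surface_bertini_of_supportedClasses_three_one_eq_top hBert hX hS i hσ hB hE h
    (supportedClasses_eq_top_of_hasChowZeroSupportedInDimLE_of_lt hX hW (by norm_num))

/-- **Uniruled-type corollary off general type**: `HC(X × X) ⟸ E(S)` for one polarising surface section, GRANTED `CH₀(X)` on a surface,
`CH₀(X × C)`, `CH₀(C × X)` in dimension `≤ 3` for all curves `C` (so `HC22C[X]` by Bloch–Srinivas, `hodgeTwoTwo_timesCurve_of_chowZero`),
`κ(X) < 3` (Tankeev's named fact for `B⋆(X)`) and the Hartshorne–Bertini named fact. CONDITIONAL on those two named facts.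
[cite: Tankeev2011, main theorem] [cite: BlochSrinivas1983, Thm. 1 (2)–(3)] [cite: Hartshorne1977, II Thm. 8.18 and III Cor. 7.9] -/
theorem hodgeConjectureFor_sq_of_tankeev_bertini_surface_chowZero (hT : Tankeev2011_lefschetzStandard_threefold_kodairaDim_lt_three)
    (hBert : Hartshorne1977_bertini_smoothHyperplaneSections) (hX : IsSmoothProjective 3 X) (hκ : ¬ Motives.IsOfGeneralType 3 X)
    (hW : HasChowZeroSupportedInDimLE X 2)
    (hWC : ∀ ⦃C : SchemeOver ℂ⦄, IsSmoothProjective 1 C →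
      HasChowZeroSupportedInDimLE (X ⊗ C) 3 ∧ HasChowZeroSupportedInDimLE (C ⊗ X) 3)
    (hS : IsSmoothProjective 2 S) (i : S ⟶ X) (hσ : IsPolarizationClass 3 X (SecCl[hS, hX, i])) (hE : ES[S]) :
    HodgeConjectureFor 6 (X ⊗ X) :=
  hodgeConjectureFor_sq_of_B_surface_bertini_of_hasChowZeroSupportedInDimLE_two hBert hX hW hS i hσ (hT hX hκ) hE
    (hodgeTwoTwo_timesCurve_of_chowZero hX hWC)

end Summit.HodgeConjecture.HodgeConjecture.Theorems.ThreefoldSquare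

end
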